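import Summits.RiemannHypothesis.RiemannHypothesis.Theorems.TiltedLandingLaw421R3IsoTilt2

/-! # TiltedLandingLaw421R3FarStep — W-08 RATE^B support: the FAR-STEP KIT = EXACT CRITICAL-POINT ALGEBRA

SUPPORT module for crux `TiltedLandingLaw421` (stmt-RiemannHypothesis-24774), `--supports … --as helper` only; sorry-free; imports ONLY the landed
`…R3IsoTilt2` (#1037: `pairQ`, `deriv_pair_mul`, `exists_pair_factor_real`, `cofactor_eq_quot`).

(CA371)(2) (betaR g3 STUCK on «critical-point displacement lower bound from the bounded field»): at any critical point `w` of
`G = (z − v)(z − v̄)·h` with field `K := h′/h`, `((w − a)² + b²)·K(w) = −2(w − a)` (`v = a + ib`); hence for a REAL value `K(w) = κ` the non-real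
critical point lies ON `v`'s Jensen circle with `Re w = a − 1/κ` and `Im w² = b² − 1/κ²` (energy drop exactly `1/κ²`), and in general the two real
equations below are what the perturbative clause has to bound.
* §F.1 (K) `crit_pair_identity` / `crit_field_identity` (+ the `f^{(j)}` form `crit_field_identity_iteratedDeriv`): the identity, from `deriv_pair_mul`.
* §F.2 (K) `realField_crit`: `κ : ℝ`, `κ ≠ 0`, `Im w ≠ 0`, `q(w)·κ = −2(w − a)` ⇒ `Re w = a − 1/κ ∧ b² − Im w² = 1/κ² ∧ normSq (w − a) = b²`.
* §F.3 (K) `field_crit_re_im`: for a COMPLEX field value `K`, `q(w)·K = −2(w − a)` ⇒ the exact pair of real equations.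
* §F.4 (K) `drop_formula`: eliminating `Re w − a` — the sign of `Im K(w)` decides whether the drop beats `1/|K(w)|²`.
* §F.5 (K) `realField_drop_ge`, `realField_far_energy` (`M = η/s`: `s² ≤ η²(b² − Im w²)`, the `FarEnergyLawQ` summand shape).
Compiled from C4 rh-idea-6 g28 «kernel desk» sha256 6fef4b0044893073f13352f17147ccce26af1ae1d84131810ad67451d1b2f420 (175 l).
Nothing here bears on the truth of RH; RH is not proved; 24774 OPEN. -/

namespace RhW08.FarStep

open Complex Metric Set
open scoped ComplexConjugate
open RhW08.IsolatedTilt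

/-! ## §F.1 the critical-point identity -/

/-- ★ (K) §F.1 **CRITICAL-POINT IDENTITY**: `G = q·h` on `ball a ρ`, `w` in the ball, `G′ w = 0` ⇒ `q(w)·h′(w) = −2(w − a)·h(w)`. -/
theorem crit_pair_identity {G h : ℂ → ℂ} {a b ρ : ℝ} (hh : DifferentiableOn ℂ h (ball (a : ℂ) ρ))
    (hG : ∀ z ∈ ball (a : ℂ) ρ, G z = pairQ a b z * h z) {w : ℂ} (hw : w ∈ ball (a : ℂ) ρ) (hcrit : deriv G w = 0) :
    pairQ a b w * deriv h w = -(2 * (w - a) * h w) := by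
  have := deriv_pair_mul hh hG hw
  rw [hcrit] at this
  linear_combination -this

/-- ★ (K) §F.1 … in FIELD form (`K := h′/h`, `h w ≠ 0`): `q(w)·K(w) = −2(w − a)`, i.e. `(w − a)² + b² = −2(w − a)/K(w)` when `K(w) ≠ 0`. -/
theorem crit_field_identity {G h : ℂ → ℂ} {a b ρ : ℝ} (hh : DifferentiableOn ℂ h (ball (a : ℂ) ρ))
    (hG : ∀ z ∈ ball (a : ℂ) ρ, G z = pairQ a b z * h z) {w : ℂ} (hw : w ∈ ball (a : ℂ) ρ) (hhw : h w ≠ 0)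
    (hcrit : deriv G w = 0) : pairQ a b w * (deriv h w / h w) = -(2 * (w - a)) := by
  have := crit_pair_identity hh hG hw hcrit
  field_simp
  linear_combination this

/-- (K) §F.1 the same for `G := f^{(j)}` at a zero `w` of `f^{(j+1)}` (`(f^{(j)})′ = f^{(j+1)}`). -/
theorem crit_field_identity_iteratedDeriv {f h : ℂ → ℂ} {j : ℕ} {a b ρ : ℝ} (hh : DifferentiableOn ℂ h (ball (a : ℂ) ρ))
    (hG : ∀ z ∈ ball (a : ℂ) ρ, iteratedDeriv j f z = pairQ a b z * h z) {w : ℂ} (hw : w ∈ ball (a : ℂ) ρ) (hhw : h w ≠ 0)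
    (hcrit : iteratedDeriv (j + 1) f w = 0) : pairQ a b w * (deriv h w / h w) = -(2 * (w - a)) := by
  refine crit_field_identity hh hG hw hhw ?_
  rw [← hcrit, iteratedDeriv_succ]

/-! ## §F.2 the REAL-FIELD case: the critical point sits ON the Jensen circle, shifted by `−1/κ`, with energy drop `1/κ²` -/

/-- (K) real and imaginary parts of the pair factor. -/
theorem pairQ_re (a b : ℝ) (w : ℂ) : (pairQ a b w).re = (w.re - a) ^ 2 - w.im ^ 2 + b ^ 2 := by
  rw [pairQ]
  simp only [sq, Complex.add_re, Complex.mul_re, Complex.sub_re, Complex.sub_im, Complex.ofReal_re, Complex.ofReal_im]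
  ring

/-- (K) … and its imaginary part. -/
theorem pairQ_im (a b : ℝ) (w : ℂ) : (pairQ a b w).im = 2 * (w.re - a) * w.im := by
  rw [pairQ]
  simp only [sq, Complex.add_im, Complex.mul_im, Complex.sub_re, Complex.sub_im, Complex.ofReal_re, Complex.ofReal_im]
  ring

/-- ★★ (K) §F.2 **REAL FIELD ⟹ ON THE CIRCLE**: `((w − a)² + b²)·κ = −2(w − a)` with `κ : ℝ`, `κ ≠ 0`, `Im w ≠ 0`
⇒ `Re w = a − 1/κ`, `b² − Im w² = 1/κ²` (the energy drop), and `|w − a|² = b²` (the critical point is ON `v`'s Jensen circle). -/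
theorem realField_crit {w : ℂ} {a b κ : ℝ} (hκ : κ ≠ 0) (hw : w.im ≠ 0)
    (h : pairQ a b w * (κ : ℂ) = -(2 * (w - a))) :
    w.re = a - 1 / κ ∧ b ^ 2 - w.im ^ 2 = 1 / κ ^ 2 ∧ Complex.normSq (w - a) = b ^ 2 := by
  have hre := congrArg Complex.re h
  have him := congrArg Complex.im h
  simp only [Complex.mul_re, Complex.mul_im, Complex.ofReal_re, Complex.ofReal_im, mul_zero, sub_zero, zero_add,
    pairQ_re, pairQ_im, Complex.neg_re, Complex.neg_im, Complex.sub_re, Complex.sub_im] at hre him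
  norm_num at hre him
  -- him : 2 * (w.re - a) * w.im * κ = -(2 * w.im)
  have h1 : ((w.re - a) * κ + 1) * w.im = 0 := by linear_combination (1 / 2 : ℝ) * him
  have hx : (w.re - a) * κ = -1 := by
    rcases mul_eq_zero.mp h1 with h | h
    · linarith
    · exact absurd h hw
  have h3 : (w.re - a) ^ 2 * κ ^ 2 = 1 := by
    rw [← mul_pow, hx]; norm_num
  have h2 : ((w.re - a) ^ 2 - w.im ^ 2 + b ^ 2) * κ ^ 2 = 2 := by
    have e : ((w.re - a) ^ 2 - w.im ^ 2 + b ^ 2) * κ ^ 2 = (-(2 * (w.re - a))) * κ := by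
      rw [← hre]; ring
    rw [e]
    linear_combination -2 * hx
  have h5 : (b ^ 2 - w.im ^ 2) * κ ^ 2 = 1 := by linear_combination h2 - h3
  have hκ2 : κ ^ 2 ≠ 0 := pow_ne_zero 2 hκ
  refine ⟨?_, ?_, ?_⟩
  · field_simp
    linear_combination hx
  · field_simp
    linear_combination h5
  · rw [Complex.normSq_apply, Complex.sub_re, Complex.sub_im, Complex.ofReal_re, Complex.ofReal_im, sub_zero]
    have h4 : ((w.re - a) ^ 2 - (b ^ 2 - w.im ^ 2)) * κ ^ 2 = 0 := by linear_combination h3 - h5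
    have h6 := (mul_eq_zero.mp h4).resolve_right hκ2
    linear_combination h6

/-- (K) §F.2 in the frame: `G = q·h`, critical point `w` (non-real) in the ball where the field `h′/h` takes a REAL non-zero value `κ`
⇒ `w` is on the circle with the shift and the drop above. -/
theorem crit_on_circle_of_realField {G h : ℂ → ℂ} {a b ρ κ : ℝ} (hh : DifferentiableOn ℂ h (ball (a : ℂ) ρ))
    (hG : ∀ z ∈ ball (a : ℂ) ρ, G z = pairQ a b z * h z) {w : ℂ} (hw : w ∈ ball (a : ℂ) ρ) (hhw : h w ≠ 0)
    (hcrit : deriv G w = 0) (hwim : w.im ≠ 0) (hκ : κ ≠ 0) (hK : deriv h w / h w = κ) :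
    w.re = a - 1 / κ ∧ b ^ 2 - w.im ^ 2 = 1 / κ ^ 2 ∧ Complex.normSq (w - a) = b ^ 2 := by
  have := crit_field_identity hh hG hw hhw hcrit
  rw [hK] at this
  exact realField_crit hκ hwim this

/-! ## §F.3 a COMPLEX field value: the exact pair of real equations the perturbative clause must bound -/

/-- ★ (K) §F.3 **THE TWO REAL EQUATIONS** at a critical point with field value `K`: from `q(w)·K = −2(w − a)`,
`(Re w − a)·(Im w·|K|² − Im K) = −Im w·Re K` and `(b² − Im w²)·|K|² = −(Re w − a)²·|K|² − 2((Re w − a)·Re K + Im w·Im K)`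
(for `Im K = 0` they reduce to §F.2: shift `−1/Re K`, drop `1/(Re K)²`). -/
theorem field_crit_re_im {w K : ℂ} {a b : ℝ} (h : pairQ a b w * K = -(2 * (w - a))) :
    (w.re - a) * (w.im * Complex.normSq K - K.im) = -(w.im * K.re) ∧
      (b ^ 2 - w.im ^ 2) * Complex.normSq K
        = -((w.re - a) ^ 2 * Complex.normSq K) - 2 * ((w.re - a) * K.re + w.im * K.im) := by
  -- multiply by `conj K`: `q(w)·|K|² = −2(w − a)·conj K`
  have h' : pairQ a b w * (Complex.normSq K : ℂ) = -(2 * (w - a)) * conj K := by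
    rw [Complex.normSq_eq_conj_mul_self, ← h]
    ring
  have hre := congrArg Complex.re h'
  have him := congrArg Complex.im h'
  simp only [Complex.mul_re, Complex.mul_im, Complex.ofReal_re, Complex.ofReal_im, mul_zero, sub_zero, zero_add,
    pairQ_re, pairQ_im, Complex.neg_re, Complex.neg_im, Complex.sub_re, Complex.sub_im, Complex.conj_re, Complex.conj_im] at hre him
  norm_num at hre him
  constructor
  · linear_combination (1 / 2 : ℝ) * him
  · linear_combination hre

/-! ## §F.4 the exact DROP FORMULA (division-free) and §F.5 the real-field bounds in the far-law currency -/

/-- ★ (K) §F.4 **DROP FORMULA**: with `y := Im w`, `N := |K|²`, `D := y·N − Im K`, eliminating `Re w − a` from §F.3 gives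
`(b² − y²)·N·D² = y·(Re K)²·(y·N − 2·Im K) − 2·y·(Im K)·D²` — for `Im K = 0` this is `drop = 1/N`; the first-order correction is `−2y·Im K/N`,
so the SIGN of `Im K(w)` decides whether the drop exceeds `1/|K(w)|²`. -/
theorem drop_formula {w K : ℂ} {a b : ℝ} (h : pairQ a b w * K = -(2 * (w - a))) :
    (b ^ 2 - w.im ^ 2) * Complex.normSq K * (w.im * Complex.normSq K - K.im) ^ 2
      = w.im * K.re ^ 2 * (w.im * Complex.normSq K - 2 * K.im) - 2 * w.im * K.im * (w.im * Complex.normSq K - K.im) ^ 2 := by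
  obtain ⟨h1, h2⟩ := field_crit_re_im h
  linear_combination ((w.im * Complex.normSq K - K.im) ^ 2) * h2
    + (-(Complex.normSq K * ((w.re - a) * (w.im * Complex.normSq K - K.im) - w.im * K.re))
        - 2 * K.re * (w.im * Complex.normSq K - K.im)) * h1

/-- ★ (K) §F.5 **REAL FIELD, FAR-LAW CURRENCY**: `q(w)·κ = −2(w − a)` with `κ : ℝ`, `0 < |κ| ≤ M`, `Im w ≠ 0`
⇒ energy drop `b² − Im w² ≥ 1/M²` and horizontal displacement `|Re w − a| ≥ 1/M` (betaR's «displacement ≥ s/η, drop ≥ (s/η)²» at `M = η/s`). -/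
theorem realField_drop_ge {w : ℂ} {a b κ M : ℝ} (hκ : κ ≠ 0) (hw : w.im ≠ 0) (hM : |κ| ≤ M)
    (h : pairQ a b w * (κ : ℂ) = -(2 * (w - a))) :
    1 / M ^ 2 ≤ b ^ 2 - w.im ^ 2 ∧ 1 / M ≤ |w.re - a| := by
  obtain ⟨hre, hdrop, _⟩ := realField_crit hκ hw h
  have hκpos : 0 < |κ| := abs_pos.mpr hκ
  have hk2 : κ ^ 2 ≤ M ^ 2 := by
    have hMnn : 0 ≤ M := le_trans (abs_nonneg κ) hM
    nlinarith [abs_mul_abs_self κ, mul_le_mul hM hM (abs_nonneg κ) hMnn]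
  refine ⟨?_, ?_⟩
  · rw [hdrop]
    exact one_div_le_one_div_of_le (by positivity) hk2
  · have : w.re - a = -1 / κ := by rw [hre]; ring
    rw [this, abs_div, abs_neg, abs_one]
    exact one_div_le_one_div_of_le hκpos hM

/-- ★★ (K) §F.5 the same at `M = η/s`: drop `≥ (s/η)²`, i.e. `s² ≤ η²·(b² − Im w²)` — the summand shape of `FarEnergyLawQ`. -/
theorem realField_far_energy {w : ℂ} {a b κ η s : ℝ} (hκ : κ ≠ 0) (hw : w.im ≠ 0) (hη : 0 < η) (hs : 0 < s)
    (hM : |κ| ≤ η / s) (h : pairQ a b w * (κ : ℂ) = -(2 * (w - a))) :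
    s ^ 2 ≤ η ^ 2 * (b ^ 2 - w.im ^ 2) := by
  have h1 := (realField_drop_ge hκ hw hM h).1
  have hηs : 1 / (η / s) ^ 2 = s ^ 2 / η ^ 2 := by field_simp
  rw [hηs] at h1
  have hη2 : 0 < η ^ 2 := by positivity
  calc s ^ 2 = η ^ 2 * (s ^ 2 / η ^ 2) := by field_simp
    _ ≤ η ^ 2 * (b ^ 2 - w.im ^ 2) := mul_le_mul_of_nonneg_left h1 hη2.le

end RhW08.FarStep
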